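import Literature.AlgebraicGeometry.Resolution.ApproximationDegree
import HarnessLib

/-!
# Kaplansky unit forms: every polynomial is constant times a `1`-unit on a deep disc

Topic: `Literature/AlgebraicGeometry/Resolution` (valued function fields). A consequence of the
calculus of the relative approximation degree (F.-V. Kuhlmann, I. Vlahu, *The relative
approximation degree in valued function fields*, Math. Z. 276 (2014) = arXiv:1304.0200, §7,
Cor. 7.1; in the tree: `exists_approximationDegree`, `valuation_eval_eq_of_kaplansky`,
`ApproximationDegree.lean`) for an element `x` of transcendental immediate approximation type
over `K`: on a deep enough disc `|X − c| ≤ |x − c|` around a centre `c ∈ K`, rescaled by a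
constant `d ∈ K` of value `|x − c|` to the coordinate `X′ = (X − c)/d`, every polynomial `f`
over `K` is its (constant) value `f(c)` times a polynomial `U(X′)` over `K` with constant term
`1` and all other coefficients in the maximal ideal — a unit of `K°[X′]` of value `1` at every
point of the disc inducing `K°` on the constants. This is the finite-level form of "an
invertible function on a closed disc has constant absolute value", and the tool for descending
coefficients from the valuation ring of `K(x)` to a polynomial chart `K°[X′]` in the
algebraization step of M. Temkin, *Inseparable local uniformization*, J. Algebra 373 (2013),
Thm. 3.3.1 (tree: `Temkin2013RelativeCurveSmoothFibre`).

* `exists_unitForm` — **unit forms**: for `f` over `K` with `f(x) ≠ 0` there is a centre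
  `a₀ ∈ K` such that for every deeper centre `c ∈ K` and every `d ∈ K` with `|d| = |x − c|`,
  `f(x) = f(c) · U((x − c)/d)` with `U` over `K`, `U(0) = 1`, `|U_k| < 1` for `k ≥ 1` — PROVED;
* `valuation_eval_unitForm_eq_one` — such a `U` has value `1` at every point `w` of the disc
  (`|X′|_w ≤ 1`) which agrees with `V` on `K` — PROVED.

All statements are [folklore] given the cited results; no definitions, no named facts.

## Sources

* F.-V. Kuhlmann, I. Vlahu, Math. Z. 276 (2014) = arXiv:1304.0200, §7 and Cor. 7.1 (through the
  tree). [KuhlmannVlahu2014]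
* M. Temkin, arXiv:0804.1554v3, proof of Thm. 3.3.1, Step 3 (the use).
-/

noncomputable section

open Polynomial

namespace Literature.AlgebraicGeometry.Resolution

universe u

variable {Ω : Type u} [Field Ω] (V : ValuationSubring Ω) (K : Subfield Ω)

/-- **Kaplansky unit forms.** Let `x ∉ K` with `(K(x)|K, V)` immediate (`hval`, `hres`) and of
transcendental approximation type (`h3`), and let `f` be a polynomial over `K` with `f(x) ≠ 0`.
Then there is `a₀ ∈ K` such that for all `c ∈ K` with `|x − c| ≤ |x − a₀|` and all `d ∈ K` with
`|d| = |x − c|` there is a polynomial `U` over `K` with `U(0) = 1`, `|U_k| < 1` (`k ≥ 1`) and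
`f(x) = f(c) · U((x − c)/d)`. [cite: KuhlmannVlahu2014, Cor. 7.1] -/
theorem exists_unitForm {x : Ω} (hxK : x ∉ K)
    (hval : ∀ w ∈ Subfield.closure ((K : Set Ω) ∪ {x}), w ≠ 0 → ∃ b ∈ K,
      V.valuation w = V.valuation b)
    (hres : ∀ w ∈ Subfield.closure ((K : Set Ω) ∪ {x}), w ∈ V → ∃ c ∈ K,
      V.valuation (w - c) < 1)
    (h3 : ∀ g : Polynomial Ω, (∀ k, g.coeff k ∈ K) → ∃ a₀ ∈ K, ∃ α : V.ValueGroup,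
      ∀ a ∈ K, V.valuation (x - a) ≤ V.valuation (x - a₀) → V.valuation (g.eval a) = α)
    {f : Polynomial Ω} (hf : ∀ k, f.coeff k ∈ K) (hfx : f.eval x ≠ 0) :
    ∃ a₀ ∈ K, ∀ c ∈ K, V.valuation (x - c) ≤ V.valuation (x - a₀) →
      ∀ d ∈ K, V.valuation d = V.valuation (x - c) →
        ∃ U : Polynomial Ω, (∀ k, U.coeff k ∈ K) ∧ U.coeff 0 = 1 ∧
          (∀ k, 1 ≤ k → V.valuation (U.coeff k) < 1) ∧
          f.eval x = f.eval c * U.eval ((x - c) / d) := by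
  classical
  have hxc : ∀ c ∈ K, x - c ≠ 0 := fun c hc h => hxK (by rw [sub_eq_zero.mp h]; exact hc)
  -- Cor. 7.1: the value of `f` at deep centres is `|f(x)|`, strictly dominating `|f(x) − f(c)|`
  obtain ⟨a₂, ha₂K, H2⟩ := valuation_eval_eq_of_kaplansky V K hxK hval hres h3 hf
  by_cases hdeg : f.natDegree = 0
  · -- constant polynomial: `U = 1`
    obtain ⟨c₀, hc₀⟩ := natDegree_eq_zero.mp hdeg
    refine ⟨a₂, ha₂K, fun c hc _ d _ _ => ⟨1, fun k => ?_, by simp, fun k hk => ?_, ?_⟩⟩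
    · rw [coeff_one]
      split_ifs
      · exact K.one_mem
      · exact K.zero_mem
    · rw [coeff_one, if_neg (by omega), map_zero]
      exact zero_lt_one
    · rw [← hc₀, eval_C, eval_C, eval_one, mul_one]
  -- non-constant: the dominant Taylor index
  obtain ⟨hh, h1h, -, β, hβ0, a₁, ha₁K, H1⟩ :=
    exists_approximationDegree V K hxK hval hres h3 hf (Nat.pos_of_ne_zero hdeg)
  -- the deeper of the two centres
  obtain ⟨a₀, ha₀K, ha₀₁, ha₀₂⟩ : ∃ a₀ ∈ K, V.valuation (x - a₀) ≤ V.valuation (x - a₁) ∧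
      V.valuation (x - a₀) ≤ V.valuation (x - a₂) := by
    rcases le_total (V.valuation (x - a₁)) (V.valuation (x - a₂)) with h | h
    · exact ⟨a₁, ha₁K, le_rfl, h⟩
    · exact ⟨a₂, ha₂K, h, le_rfl⟩
  refine ⟨a₀, ha₀K, fun c hc hcle d hd hdv => ?_⟩
  obtain ⟨hβc, hdom, hdiff⟩ := H1 c hc (hcle.trans ha₀₁)
  obtain ⟨hval_c, hlt⟩ := H2 c hc (hcle.trans ha₀₂)
  have hfc0 : f.eval c ≠ 0 := fun h0 => by
    rw [h0, map_zero] at hval_c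
    exact hfx ((map_eq_zero _).mp hval_c.symm)
  have hd0 : d ≠ 0 := fun h0 => by
    rw [h0, map_zero] at hdv
    exact hxc c hc ((map_eq_zero _).mp hdv.symm)
  -- the strict domination `|f(x) − f(c)| < |f(x)| = |f(c)|`
  have hstrict : V.valuation (f.eval x - f.eval c) < V.valuation (f.eval c) := by
    rcases hlt with hlt | heq
    · rwa [hval_c]
    · exfalso
      rw [heq, sub_self, map_zero] at hdiff
      exact mul_ne_zero hβ0 (pow_ne_zero _ ((_root_.map_ne_zero _).mpr (hxc c hc))) hdiff.symm
  -- every Taylor term of positive index is `< |f(c)|`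
  have hterm : ∀ k, 1 ≤ k →
      V.valuation ((hasseDeriv k f).eval c * (x - c) ^ k) < V.valuation (f.eval c) := by
    intro k hk
    by_cases hkh : k = hh
    · subst hkh
      rw [map_mul, map_pow, hβc, ← hdiff]
      exact hstrict
    · exact lt_trans (hdom k hk hkh) (by rw [← hdiff]; exact hstrict)
  -- the unit form `U(X′) = f(c + d X′)/f(c)`
  set U : Polynomial Ω := C (f.eval c)⁻¹ * (taylor c f).comp (C d * X) with hU
  have hUcoeff : ∀ k, U.coeff k = (f.eval c)⁻¹ * ((hasseDeriv k f).eval c * d ^ k) := fun k => by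
    rw [hU, coeff_C_mul, comp_C_mul_X_coeff, taylor_coeff]
  refine ⟨U, fun k => ?_, ?_, fun k hk => ?_, ?_⟩
  · rw [hUcoeff]
    exact K.mul_mem (K.inv_mem (eval_mem_subfield_of_coeff_mem hf hc))
      (K.mul_mem (eval_mem_subfield_of_coeff_mem (coeff_hasseDeriv_mem K hf k) hc) (K.pow_mem hd k))
  · rw [hUcoeff, pow_zero, mul_one, hasseDeriv_zero', inv_mul_cancel₀ hfc0]
  · rw [hUcoeff, map_mul, map_inv₀, ← div_eq_inv_mul,
      div_lt_one₀ ((Valuation.pos_iff _).mpr hfc0), map_mul, map_pow, hdv, ← map_pow, ← map_mul]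
    exact hterm k hk
  · rw [hU, eval_mul, eval_C, eval_comp, eval_mul, eval_C, eval_X, mul_div_cancel₀ _ hd0,
      taylor_eval, sub_add_cancel, ← mul_assoc, mul_inv_cancel₀ hfc0, one_mul]

/-- `|a| < 1 ↔ a⁻¹ ∉ A` for a non-zero element and a valuation subring `A` (a private copy of
the tree lemma of `TameTowerInertiaField.lean`, to keep the imports small). [folklore] -/
private theorem valuation_lt_one_iff_inv_not_mem' (A : ValuationSubring Ω) {a : Ω} (ha : a ≠ 0) :
    A.valuation a < 1 ↔ a⁻¹ ∉ A := by
  have hpos : 0 < A.valuation a := (Valuation.pos_iff _).mpr ha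
  constructor
  · intro hlt hmem
    have h1 : A.valuation a⁻¹ ≤ 1 := (A.valuation_le_one_iff _).mpr hmem
    rw [map_inv₀, inv_le_one₀ hpos] at h1
    exact not_lt.mpr h1 hlt
  · intro hnot
    have h1 : ¬ A.valuation a⁻¹ ≤ 1 := fun h => hnot ((A.valuation_le_one_iff _).mp h)
    rw [map_inv₀, not_le, one_lt_inv₀ hpos] at h1
    exact h1

/-- Strict inequalities `|a| < 1` for constants transfer between valuation rings agreeing on the
constants. [folklore] -/
theorem valuation_lt_one_of_forall_mem_iff {W : ValuationSubring Ω} (hW : ∀ a ∈ K, a ∈ W ↔ a ∈ V)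
    {a : Ω} (haK : a ∈ K) (ha : V.valuation a < 1) : W.valuation a < 1 := by
  by_cases h0 : a = 0
  · rw [h0, map_zero]; exact zero_lt_one
  · rw [valuation_lt_one_iff_inv_not_mem' _ h0] at ha ⊢
    exact fun hmem => ha ((hW _ (K.inv_mem haK)).mp hmem)

/-- **A unit form has value `1` on the disc**: if `U` is a polynomial with coefficients in `K`,
`U(0) = 1` and `|U_k|_V < 1` for `k ≥ 1`, then `|U(z)|_w = 1` for every valuation ring `w` of `Ω`
agreeing with `V` on `K` and every `z ∈ w`. [folklore] -/
theorem valuation_eval_unitForm_eq_one {U : Polynomial Ω} (hUK : ∀ k, U.coeff k ∈ K)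
    (hU0 : U.coeff 0 = 1) (hUk : ∀ k, 1 ≤ k → V.valuation (U.coeff k) < 1)
    (W : ValuationSubring Ω) (hW : ∀ a ∈ K, a ∈ W ↔ a ∈ V) {z : Ω} (hz : z ∈ W) :
    W.valuation (U.eval z) = 1 := by
  classical
  have hlt : ∀ k, 1 ≤ k → W.valuation (U.coeff k * z ^ k) < 1 := by
    intro k hk
    have h1 : W.valuation (U.coeff k) < 1 :=
      valuation_lt_one_of_forall_mem_iff V K hW (hUK k) (hUk k hk)
    calc W.valuation (U.coeff k * z ^ k) = W.valuation (U.coeff k) * W.valuation z ^ k := by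
          rw [map_mul, map_pow]
      _ ≤ W.valuation (U.coeff k) * 1 :=
          mul_le_mul' le_rfl (pow_le_one' ((W.valuation_le_one_iff _).mpr hz) k)
      _ < 1 := by rw [mul_one]; exact h1
  rw [eval_eq_sum_range, Finset.sum_range_succ', pow_zero, mul_one, hU0, add_comm]
  refine Valuation.map_one_add_of_lt _ ?_
  exact Valuation.map_sum_lt _ one_ne_zero fun k _ => hlt (k + 1) (Nat.succ_pos k)

end Literature.AlgebraicGeometry.Resolution

end
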